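import Summits.HodgeConjecture.FermatCycles.ConditionQFourfoldSearch
import Summits.HodgeConjecture.FermatCycles.ConditionQFourfoldSixtyTable
import Summits.HodgeConjecture.FermatCycles.ConditionQFourfoldSixtyA
import HarnessLib

/-!
# Shioda's stable-generation condition `(Q⁴ₘ)` at `m = 60` and the failure of `(P⁴ₘ)` — kernel certificate (part B of 2)

HONEST FRAMING: explicit algebraic cycles for specific Hodge classes on Fermat/Delsarte varieties;
residual open instances listed; no claim on general Hodge.

Topic path `Summits/HodgeConjecture/FermatCycles/` of cell `pub-hfermat` (new work, not literature: a computer determination of the cell —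
`pub-hfermat-enum/P4-TABLE.md` §(Q⁴ₘ), two implementations — certified by the Lean kernel). Framework: `ConditionQFourfold.lean`
(certificate Booleans, searches `checkQU`/`checkQN`) and `ConditionQFourfoldSearch.lean` (`conditionQ_four_of_normalized`).

THE STATEMENT. Shioda, Math. Ann. 245 (1979) §4 p. 183: `(Qⁿₘ)` — every element of `Mₘ(y)`, `3 ≤ y ≤ n/2 + 1`, is `ξ₁ − ξ₂` with
`ξ₁, ξ₂ ∈ M'ₘ = ⟨Mₘ(1), Mₘ(2), Mₘ(3)^sd⟩` (pairs, Hodge classes of the Fermat surface, semi-decomposable sextuples); by his Claim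
(p. 183, Lemmas 2–3) `(Qⁿₘ)` may replace `(Pⁿₘ)` in Theorem III (`⇒` the Hodge conjecture for `Xⁿₘ`); p. 184: "we do not know any
value of `m` which satisfies `(Qₘ)` but not `(Pₘ)`". Tree: `Literature.AlgebraicGeometry.Shioda1979.ConditionQ m n`, `MPrime`,
`forall_of_conditionQ` (the Claim's arithmetic spine), `ConditionP` (Math. Ann. form of `(P)`), `FermatCharacter.ShiodaConditionUpTo`
(Proc. Japan Acad. form, with the semi-decomposable alternative).

WHAT IS PROVED HERE (level `m = 60`, part B).
* part B of 2: the kernel searches `checkQN 60 T 5 2`, `checkQN 60 T 7 2`, `checkQN 60 T 9 3`, `checkQN 60 T 12 3`, `checkQN 60 T 15 3`, `checkQN 60 T 18 42` (139592 tuples);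
* **`conditionQ_sixty_four : Shioda1979.ConditionQ 60 4`** — `(Q⁴ₘ)` holds at `m = 60`: every Hodge sextuple over `ℤ/60` (every Hodge character of the
  Fermat fourfold `X⁴ₘ`, `m = 60`, up to permutation) is `ξ₁ − ξ₂`, `ξᵢ ∈ M'ₘ`;
* `forall_of_closed_cancellative_sixty`: by Shioda's Claim (`forall_of_conditionQ`), every Shioda-closed, Lemma-3-cancellative family of
  multisets over `ℤ/60` contains every non-empty Hodge multiset of cardinality `≤ 6`;
* the NEGATIVE side on the sextuple `s = (1, 3, 32, 44, 49, 51)`: Hodge (`isHodgeMultiset_fail_sixty`), no proper non-empty sub-multiset with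
  zero sum (`sum_ne_zero_of_mem_powerset_fail_sixty`: hence not decomposable, not semi-decomposable), not quasi-decomposable (`fail_sixty_key`,
  `60 · 2⁸` kernel cases) ⇒ **`not_shiodaConditionUpTo_sixty_four : ¬ ShiodaConditionUpTo 60 4`** (the Proc. Japan Acad. form of `(P⁴ₘ)`
  fails), `not_conditionP_sixty_four : ¬ Shioda1979.ConditionP 60 4` (the Math. Ann. form fails), and the conjunction
  `conditionQ_not_conditionP_sixty : ConditionQ 60 4 ∧ ¬ ConditionP 60 4` — at `m = 60`, for fourfolds, Shioda's weakening `(Q)` of `(P)` is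
  NECESSARY as well as sufficient.

NUMBERS (this seat's search `code/lit/q4/q4norm.py` = implementation 2; implementation 1 = ENUM `code/enum/q4table.py`,
`data/shioda_Q4_m3-100.json`): case U visits 54246 sorted tuples and case N 147593; 12579 of them are Hodge sextuples; all but 43 carry a
`(P)`-witness (case N pair 7216, case N quasi 2688, case N semi 384, case U pair 1577, case U quasi 621, case U semi 50); the other 43 — `(1, 3, 32, 44, 49, 51)` (case U); `(1, 8, 9, 49, 56, 57)` (case U); `(1, 8, 27, 39, 49, 56)` (case U); `(1, 13, 16, 41, 53, 56)` (case U); `(1, 16, 25, 31, 52, 55)` (case U); `(1, 17, 27, 31, 47, 57)` (case U); `(1, 17, 32, 37, 41, 52)` (case U); `(1, 21, 23, 31, 51, 53)` (case U); `(1, 21, 32, 33, 44, 49)` (case U); `(3, 4, 15, 51, 52, 55)` (case N); `(3, 4, 25, 45, 51, 52)` (case N); `(3, 5, 32, 39, 45, 56)` (case N); `(3, 5, 32, 44, 45, 51)` (case N); `(3, 15, 16, 39, 52, 55)` (case N); `(3, 15, 32, 35, 39, 56)` (case N); `(3, 15, 32, 35, 44, 51)` (case N); `(3, 16, 25, 39,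 45, 52)` (case N); `(4, 15, 21, 28, 55, 57)` (case N); `(4, 15, 21, 33, 52, 55)` (case N); `(4, 15, 27, 28, 51, 55)` (case N); `(4, 16, 25, 28, 52, 55)` (case N); `(4, 21, 25, 28, 45, 57)` (case N); `(4, 21, 25, 33, 45, 52)` (case N); `(4, 25, 27, 28, 45, 51)` (case N); `(5, 8, 9, 45, 56, 57)` (case N); `(5, 8, 21, 44, 45, 57)` (case N); `(5, 8, 27, 39, 45, 56)` (case N); `(5, 8, 27, 44, 45, 51)` (case N); `(5, 8, 32, 35, 44, 56)` (case N); `(5, 9, 32, 33, 45, 56)` (case N); `(5, 21, 32, 33, 44, 45)` (case N); `(8, 9, 15, 35, 56, 57)` (case N); `(8, 15, 21, 35, 44, 57)` (case N); `(8, 15, 27, 35, 39, 56)` (case N); `(8, 15, 27, 35, 44, 51)` (case N); `(9, 15, 16, 28, 55, 57)` (case N); `(9, 15, 16, 33, 52, 55)` (case N); `(9, 15, 32, 33, 35, 56)` (case N); `(9, 16, 25, 28, 45, 57)` (case N); `(9, 16, 25, 33, 45, 52)` (case N); `(15, 16, 27, 28, 39, 55)` (case N); `(15, 21, 32, 33,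 35, 44)` (case N); `(16, 25, 27, 28, 39, 45)` (case N) — carry the table
certificate(s) written out in the statements below (generators checked by `genB`, the identity `s + ΣX = ΣY` by `decide`, all inside the kernel search).

PRINT STATUS (lit seat, 2026-08-20). `60 = 2²·3·5`: HC for every `Xⁿ₆₀` IS in print (Aoki 2000 Thm 0.1 (i), p. 185, `d = 0`). The point of this level is Shioda's QUESTION (p. 184): `(Q⁴₆₀)` holds while `(P⁴₆₀)` fails (cell table, two implementations; kernel here).

References: [Shioda1979HodgeFermat] T. Shioda, Math. Ann. 245 (1979) 175–184, §3 p. 180 (`(Pⁿₘ)`), §4 pp. 183–184 (`M'ₘ`, `(Qⁿₘ)`, Claim,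
the question); [Shioda1979PJA] T. Shioda, Proc. Japan Acad. 55A (1979) §1 (Definition (i)–(iii), `(Pⁿₘ)'`); [daSilva2021HodgeFermat]
G. da Silva Jr., Experimental Results 2 (2021) e22, Def. 2.4, Question 1; [Aoki2000FermatTypeRemarks] N. Aoki, Comment. Math. Univ.
St. Pauli 49 (2000), Thm 0.1. Cell: `pub-hfermat-enum/P4-TABLE.md`, `data/shioda_Q4_m3-100.json`, `code/lit/q4/` (this seat).
-/

namespace Summit.HodgeConjecture.FermatCycles.ConditionQFourfold

open Multiset
open Literature.AlgebraicGeometry.HodgeTheory Literature.AlgebraicGeometry.HodgeTheory.FermatCharacter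
open Literature.AlgebraicGeometry.Shioda1982 Literature.AlgebraicGeometry.Shioda1979
open Summit.HodgeConjecture.FermatCycles.ShiodaConditionFourfold

/-! ### Level `60` — part B -/

/-! The certificate table at level `60` is the definition `table60` of `ConditionQFourfoldSixtyTable.lean` (43 entries `(key, X, Y)`,
`s + ΣX = ΣY`; found by `code/lit/q4/q4norm.py`, every entry checked by the kernel inside the searches). -/

set_option maxHeartbeats 0 in
/-- The `(Q)`-search at level `60`, case N, first free representative in `[5, 7)` (38729 tuples). Kernel.
[cite: Shioda1979HodgeFermat, §4 condition (Qⁿₘ), p. 183] -/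
theorem checkQN_60_5 :
    checkQN 60
      table60
      5 2 = true := by
  decide +kernel

set_option maxHeartbeats 0 in
/-- The `(Q)`-search at level `60`, case N, first free representative in `[7, 9)` (17634 tuples). Kernel.
[cite: Shioda1979HodgeFermat, §4 condition (Qⁿₘ), p. 183] -/
theorem checkQN_60_7 :
    checkQN 60
      table60
      7 2 = true := by
  decide +kernel

set_option maxHeartbeats 0 in
/-- The `(Q)`-search at level `60`, case N, first free representative in `[9, 12)` (30475 tuples). Kernel.
[cite: Shioda1979HodgeFermat, §4 condition (Qⁿₘ), p. 183] -/
theorem checkQN_60_9 :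
    checkQN 60
      table60
      9 3 = true := by
  decide +kernel

set_option maxHeartbeats 0 in
/-- The `(Q)`-search at level `60`, case N, first free representative in `[12, 15)` (23195 tuples). Kernel.
[cite: Shioda1979HodgeFermat, §4 condition (Qⁿₘ), p. 183] -/
theorem checkQN_60_12 :
    checkQN 60
      table60
      12 3 = true := by
  decide +kernel

set_option maxHeartbeats 0 in
/-- The `(Q)`-search at level `60`, case N, first free representative in `[15, 18)` (15599 tuples). Kernel.
[cite: Shioda1979HodgeFermat, §4 condition (Qⁿₘ), p. 183] -/
theorem checkQN_60_15 :
    checkQN 60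
      table60
      15 3 = true := by
  decide +kernel

set_option maxHeartbeats 0 in
/-- The `(Q)`-search at level `60`, case N, first free representative in `[18, 60)` (13960 tuples). Kernel.
[cite: Shioda1979HodgeFermat, §4 condition (Qⁿₘ), p. 183] -/
theorem checkQN_60_18 :
    checkQN 60
      table60
      18 42 = true := by
  decide +kernel

/-- **`(Q⁴ₘ)` holds at `m = 60`**: every Hodge sextuple over `ℤ/60` is `ξ₁ − ξ₂` with `ξ₁, ξ₂ ∈ M'ₘ` (stably generated by pairs, Hodge
`4`-sets and semi-decomposable sextuples). Kernel certificate of the cell's entry `60 ∈ Q4_true_P4_false` (P4-TABLE §(Q⁴ₘ)).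
[cite: Shioda1979HodgeFermat, §4 condition (Qⁿₘ), p. 183] -/
theorem conditionQ_sixty_four : ConditionQ 60 4 :=
  haveI : Fact (1 < 60) := ⟨by norm_num⟩
  conditionQ_four_of_normalized 60
    table60
    [(1, 59)]
    (by
      intro b h0 hN
      exact ⟨(1, 59), by simp, by omega, by omega⟩)
    (by
      intro p hp
      simp only [List.mem_cons, List.not_mem_nil, or_false] at hp
      subst hp
      exact checkQU_60_1)
    [(1, 4), (5, 2), (7, 2), (9, 3), (12, 3), (15, 3), (18, 42)]
    (by
      intro a h0 hN
      rcases Nat.lt_or_ge a 5 with h0 | h0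
      · exact ⟨(1, 4), by simp, by omega, by omega⟩
      rcases Nat.lt_or_ge a 7 with h1 | h1
      · exact ⟨(5, 2), by simp, by omega, by omega⟩
      rcases Nat.lt_or_ge a 9 with h2 | h2
      · exact ⟨(7, 2), by simp, by omega, by omega⟩
      rcases Nat.lt_or_ge a 12 with h3 | h3
      · exact ⟨(9, 3), by simp, by omega, by omega⟩
      rcases Nat.lt_or_ge a 15 with h4 | h4
      · exact ⟨(12, 3), by simp, by omega, by omega⟩
      rcases Nat.lt_or_ge a 18 with h5 | h5
      · exact ⟨(15, 3), by simp, by omega, by omega⟩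
      exact ⟨(18, 42), by simp, by omega, by omega⟩)
    (by
      intro p hp
      simp only [List.mem_cons, List.not_mem_nil, or_false] at hp
      rcases hp with rfl | rfl | rfl | rfl | rfl | rfl | rfl
      · exact checkQN_60_1
      · exact checkQN_60_5
      · exact checkQN_60_7
      · exact checkQN_60_9
      · exact checkQN_60_12
      · exact checkQN_60_15
      · exact checkQN_60_18)

/-- **Shioda's Claim at `m = 60`**: every family of multisets over `ℤ/60` closed under the inductive structure of Fermat varieties
(pairs, surface classes, semi / star / hash) and under Lemma 3's cancellation contains every non-empty Hodge multiset with at most `6`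
elements — the arithmetic form of "`(Q⁴ₘ)` ⇒ the Hodge conjecture for `X⁴ₘ`" at `m = 60` (geometric inputs = the hypotheses, as printed).
[cite: Shioda1979HodgeFermat, §4 Claim, Lemmas 2–3, p. 183] -/
theorem forall_of_closed_cancellative_sixty {C : Multiset (ZMod 60) → Prop} (hC : IsShiodaClosed C) (hL : IsCancellative C) :
    ∀ s : Multiset (ZMod 60), s ≠ 0 → IsHodgeMultiset s → card s ≤ 6 → C s :=
  forall_of_conditionQ hC hL conditionQ_sixty_four

/-! ### The negative side at `m = 60`: `(P⁴ₘ)` fails on `s = (1, 3, 32, 44, 49, 51)` -/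

/-- `s` is a Hodge sextuple over `ℤ/60` (a Hodge character of the Fermat fourfold of degree `60`). [cite: Shioda1979PJA, §1 eqs. (2)–(3)] -/
theorem isHodgeMultiset_fail_sixty : IsHodgeMultiset ({1, 3, 32, 44, 49, 51} : Multiset (ZMod 60)) :=
  isHodgeMultiset_of_hodgeUB (N := 60) (by decide +kernel)

/-- Every proper non-empty sub-multiset of `s` has non-zero sum: `s` contains no pair `{a, −a}`, no Hodge sub-multiset, no zero-sum
triple. [cite: Shioda1979PJA, §1 Definition (i), (iii)] -/
theorem sum_ne_zero_of_mem_powerset_fail_sixty :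
    ∀ t ∈ Multiset.powerset ({1, 3, 32, 44, 49, 51} : Multiset (ZMod 60)), t ≠ 0 → ({1, 3, 32, 44, 49, 51} : Multiset (ZMod 60)) - t ≠ 0 → t.sum ≠ 0 := by
  decide +kernel

/-- `s` is **not decomposable** (a summand would be a proper non-empty zero-sum sub-multiset). [cite: Shioda1979PJA, §1 Definition (i)] -/
theorem not_isDecomposable_fail_sixty : ¬ IsDecomposable ({1, 3, 32, 44, 49, 51} : Multiset (ZMod 60)) := by
  rintro ⟨t, u, ht0, hu0, ht, -, heq⟩
  have htle : t ≤ ({1, 3, 32, 44, 49, 51} : Multiset (ZMod 60)) := heq ▸ Multiset.le_add_right t u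
  have hu : ({1, 3, 32, 44, 49, 51} : Multiset (ZMod 60)) - t = u := by rw [heq, add_tsub_cancel_left]
  exact sum_ne_zero_of_mem_powerset_fail_sixty t (Multiset.mem_powerset.2 htle) ht0 (hu ▸ hu0) ht.1.2

/-- `s` is **not semi-decomposable** (no zero-sum triple). [cite: Shioda1979PJA, §1 Definition (iii)] -/
theorem not_isSemiDecomposable_fail_sixty : ¬ IsSemiDecomposable ({1, 3, 32, 44, 49, 51} : Multiset (ZMod 60)) := by
  rintro ⟨t, u, ht3, hu3, hts, -, heq⟩
  have htle : t ≤ ({1, 3, 32, 44, 49, 51} : Multiset (ZMod 60)) := heq ▸ Multiset.le_add_right t u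
  have hu : ({1, 3, 32, 44, 49, 51} : Multiset (ZMod 60)) - t = u := by rw [heq, add_tsub_cancel_left]
  have ht0 : t ≠ 0 := by rintro rfl; simp at ht3
  have hu0 : u ≠ 0 := by rintro rfl; simp at hu3
  exact sum_ne_zero_of_mem_powerset_fail_sixty t (Multiset.mem_powerset.2 htle) ht0 (hu ▸ hu0) hts

/-- A Hodge multiset over `ℤ/60` satisfies the finitely many conditions used by the kernel refutation below (entries non-zero, sum
zero, Shioda's norm equation at the units `1, 19, 7, 11` — a sub-family of Shioda's equations (2) that already admits no splitting, chosen by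
`code/lit/q4/minunits.py`). [cite: Shioda1979PJA, §1 eq. (2)] -/
theorem hodgeConditions_sixty {v : Multiset (ZMod 60)} (hv : IsHodgeMultiset v) :
    ((v).sum = 0 ∧ (∀ a ∈ v, a ≠ 0) ∧
            2 * mNormSum ((v).map fun a ↦ (1 : ZMod 60) * a) = 60 * Multiset.card (v) ∧
            2 * mNormSum ((v).map fun a ↦ (19 : ZMod 60) * a) = 60 * Multiset.card (v) ∧
            2 * mNormSum ((v).map fun a ↦ (7 : ZMod 60) * a) = 60 * Multiset.card (v) ∧
            2 * mNormSum ((v).map fun a ↦ (11 : ZMod 60) * a) = 60 * Multiset.card (v)) := by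
  have h1 := hv.2 (Units.mkOfMulEqOne 1 1 (by decide))
  have h19 := hv.2 (Units.mkOfMulEqOne 19 19 (by decide))
  have h7 := hv.2 (Units.mkOfMulEqOne 7 43 (by decide))
  have h11 := hv.2 (Units.mkOfMulEqOne 11 11 (by decide))
  simp only [Units.val_mkOfMulEqOne] at h1 h19 h7 h11
  exact ⟨hv.1.2, hv.1.1, h1, h19, h7, h11⟩

set_option maxHeartbeats 0 in
/-- The arithmetic heart of "`s` is **not quasi-decomposable**": for every `e ∈ ℤ/60` and every splitting `s + {e, −e} = t + u` into
non-empty parts different from `s`, one of `t`, `u` violates a condition of `hodgeConditions_sixty` (the zero-sum test comes first, so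
the kernel discards almost every splitting on one addition). Kernel, one residue `e` at a time (`60 · 2⁸` cases). [cite: daSilva2021HodgeFermat, Def. 2.4] [cite: Shioda1979PJA, §1 Definition (ii)] -/
theorem fail_sixty_key :
    ∀ e : ZMod 60, ∀ t ∈ Multiset.powerset (({1, 3, 32, 44, 49, 51} : Multiset (ZMod 60)) + {e, -e}),
      ¬ (((t).sum = 0 ∧ (∀ a ∈ t, a ≠ 0) ∧
            2 * mNormSum ((t).map fun a ↦ (1 : ZMod 60) * a) = 60 * Multiset.card (t) ∧
            2 * mNormSum ((t).map fun a ↦ (19 : ZMod 60) * a) = 60 * Multiset.card (t) ∧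
            2 * mNormSum ((t).map fun a ↦ (7 : ZMod 60) * a) = 60 * Multiset.card (t) ∧
            2 * mNormSum ((t).map fun a ↦ (11 : ZMod 60) * a) = 60 * Multiset.card (t)) ∧
          (((({1, 3, 32, 44, 49, 51} : Multiset (ZMod 60)) + {e, -e}) - t).sum = 0 ∧ (∀ a ∈ (({1, 3, 32, 44, 49, 51} : Multiset (ZMod 60)) + {e, -e}) - t, a ≠ 0) ∧
            2 * mNormSum (((({1, 3, 32, 44, 49, 51} : Multiset (ZMod 60)) + {e, -e}) - t).map fun a ↦ (1 : ZMod 60) * a) = 60 * Multiset.card ((({1, 3, 32, 44, 49, 51} : Multiset (ZMod 60)) + {e, -e}) - t) ∧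
            2 * mNormSum (((({1, 3, 32, 44, 49, 51} : Multiset (ZMod 60)) + {e, -e}) - t).map fun a ↦ (19 : ZMod 60) * a) = 60 * Multiset.card ((({1, 3, 32, 44, 49, 51} : Multiset (ZMod 60)) + {e, -e}) - t) ∧
            2 * mNormSum (((({1, 3, 32, 44, 49, 51} : Multiset (ZMod 60)) + {e, -e}) - t).map fun a ↦ (7 : ZMod 60) * a) = 60 * Multiset.card ((({1, 3, 32, 44, 49, 51} : Multiset (ZMod 60)) + {e, -e}) - t) ∧
            2 * mNormSum (((({1, 3, 32, 44, 49, 51} : Multiset (ZMod 60)) + {e, -e}) - t).map fun a ↦ (11 : ZMod 60) * a) = 60 * Multiset.card ((({1, 3, 32, 44, 49, 51} : Multiset (ZMod 60)) + {e, -e}) - t)) ∧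
          t ≠ 0 ∧ (({1, 3, 32, 44, 49, 51} : Multiset (ZMod 60)) + {e, -e}) - t ≠ 0 ∧ t ≠ ({1, 3, 32, 44, 49, 51} : Multiset (ZMod 60)) ∧ (({1, 3, 32, 44, 49, 51} : Multiset (ZMod 60)) + {e, -e}) - t ≠ ({1, 3, 32, 44, 49, 51} : Multiset (ZMod 60))) := by
  intro e
  obtain ⟨k, hk, rfl⟩ : ∃ k < 60, ((k : ℕ) : ZMod 60) = e :=
    ⟨e.val, e.val_lt, ZMod.natCast_zmod_val e⟩
  interval_cases k <;> decide +kernel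

/-- `s` is **not quasi-decomposable** (no `e ≠ 0` with `s + {e, −e} = ξ' + ξ''`, `ξ', ξ''` Hodge, both different from `s`).
[cite: daSilva2021HodgeFermat, Def. 2.4] [cite: Shioda1979PJA, §1 Definition (ii)] -/
theorem not_isQuasiDecomposable_fail_sixty : ¬ IsQuasiDecomposable ({1, 3, 32, 44, 49, 51} : Multiset (ZMod 60)) := by
  rintro ⟨e, -, t, u, ht0, hu0, ht, hu, hts, hus, heq⟩
  have htle : t ≤ ({1, 3, 32, 44, 49, 51} : Multiset (ZMod 60)) + {e, -e} := heq ▸ Multiset.le_add_right t u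
  have hu' : ({1, 3, 32, 44, 49, 51} : Multiset (ZMod 60)) + {e, -e} - t = u := by rw [heq, add_tsub_cancel_left]
  subst hu'
  exact fail_sixty_key e t (Multiset.mem_powerset.2 htle)
    ⟨hodgeConditions_sixty ht, hodgeConditions_sixty hu, ht0, hu0, hts, hus⟩

/-- **`(P⁴ₘ)` fails at `m = 60`** (Proc. Japan Acad. form, tree `ShiodaConditionUpTo 60 4`): the Hodge sextuple `s` is neither decomposable,
nor quasi-decomposable, nor semi-decomposable. Kernel certificate of the cell's P4-TABLE entry (two implementations + referee).
[cite: Shioda1979PJA, §1 condition (Pⁿₘ)] -/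
theorem not_shiodaConditionUpTo_sixty_four : ¬ ShiodaConditionUpTo 60 4 := fun h ↦ by
  rcases h _ isHodgeMultiset_fail_sixty (by decide) (by decide) with hd | hq | hs
  · exact not_isDecomposable_fail_sixty hd
  · exact not_isQuasiDecomposable_fail_sixty hq
  · exact not_isSemiDecomposable_fail_sixty hs

/-- Hence `(Pₘ)` (Proc. Japan Acad. form, all lengths) fails at `m = 60`. [cite: Shioda1979PJA, §1 conditions (Pⁿₘ), (Pₘ)] -/
theorem not_shiodaCondition_sixty : ¬ ShiodaCondition 60 := fun h ↦
  not_shiodaConditionUpTo_sixty_four (shiodaCondition_iff_forall_upTo.1 h 4)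

/-- **The Math. Ann. form of `(P⁴ₘ)` fails at `m = 60`** too: `s` is indecomposable and not quasi-decomposable.
[cite: Shioda1979HodgeFermat, §3 condition (Pⁿₘ), p. 180] -/
theorem not_conditionP_sixty_four : ¬ ConditionP 60 4 := fun h ↦
  not_isQuasiDecomposable_fail_sixty
    (h _ isHodgeMultiset_fail_sixty (by decide) (by decide) not_isDecomposable_fail_sixty)

/-- Hence the Math. Ann. condition `(Pₘ)` fails at `m = 60`. [cite: Shioda1979HodgeFermat, §3 condition (Pₘ), p. 180] -/
theorem not_conditionPAll_sixty : ¬ ConditionPAll 60 := fun h ↦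
  not_conditionP_sixty_four (conditionPAll_iff_forall.1 h 4)

/-- **Shioda's question (Math. Ann. 245, p. 184), the fourfold instance at `m = 60`**: "we do not know any value of `m` which satisfies
`(Qₘ)` but not `(Pₘ)`" — at `m = 60` the length-`3` condition `(Q⁴ₘ)` HOLDS while `(P⁴ₘ)` FAILS (in both printed forms). Whether `(Qₘ)` holds
at ALL lengths for `m = 60` is not decided here. Computer-assisted (cell `pub-hfermat`, two implementations), certified by the kernel.
[cite: Shioda1979HodgeFermat, §4, p. 184 (the question)] -/
theorem conditionQ_not_conditionP_sixty : ConditionQ 60 4 ∧ ¬ ConditionP 60 4 :=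
  ⟨conditionQ_sixty_four, not_conditionP_sixty_four⟩

end Summit.HodgeConjecture.FermatCycles.ConditionQFourfold
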